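import Mathlib
import Literature.Analysis.ODE.LinearComparison
import Literature.Analysis.FluidPDE.Tao2016AveragedNS.ViscousEnvelopeSmoothing
import Summits.NavierStokesRegularity.NavierStokesRegularity.Theorems.SubOnsagerCeilingForwardTailCeilingKPDyadicRange
import HarnessLib

/-!
# Global regular solutions of Tao's viscous dyadic lattice at EVERY scale ratio `1 + ε₀ ∈ [17/10, 2]`
(consequence of the rung `dyadicRange_shellBarrier` under crux stmt-NavierStokesRegularity-27057;
helper file, `--supports`)

**What is proved.** For every `ε₀ ∈ [7/10, 1]`, every scale `c ∈ (0, 1]`, every viscosity `ν > 0`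
and every one-shell datum `X₀`, the NS-scaled viscous lattice with the table `c · dyadicTable`
(the Katz–Pavlović chain on component `0`) has a GLOBAL REGULAR solution
(`dyadicRange_viscousGlobal : ∃ X, ViscousGlobal ε₀ ν (c·dyadicTable) X₀ X`), and consequently
Theorem-4.2-level blow-up FAILS for these tables (`dyadicRange_not_noGlobalCascade :
¬ NoGlobalCascade ε₀ (c·dyadicTable) X₀`) — the KP conjunct of the rung target TL-M2Break on the
one-mode chain class, at every scale ratio `b ∈ [1.7, 2]`.

PROOF. The ν-uniform shell barrier `(1+ε₀)^{2θk}·½X² ≤ 100·E₀`, `θ = 101/200`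
(`dyadicRange_shellBarrier`, re-tuned Barbato–Morandin–Romito region, valid for `b ∈ [17/10, 2]`),
along every regular solution — non-negativity on the shells `≥ 1` being automatic for the chain
(`scaledDyadic_nonneg`: variation of constants, Cheskidov positivity) — sums to the SUBCRITICAL
ENVELOPE `Σ_{k=n..N} Σ_i ½X² ≤ 400E₀/(1−(1+ε₀)^{-2θ}) · (1+ε₀)^{-(1+η)n}`, `η = 2θ − 1 = 1/100`,
uniformly in the window and in `ν`; the tree's smoothing engine
`exists_viscousGlobal_of_subcriticalEnvelope_of_inTableClass` (Duhamel bootstrap) then gives a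
global regular solution for every `ν > 0`, and `hasGlobal_of_viscousGlobal` / `hasGlobal_mono` /
`noGlobalCascade_iff_kappa` give `¬ NoGlobalCascade`. For `b = 2` this is Barbato–Morandin–Romito
2011, Thm. 1 (in the tree: `exists_viscousGlobal_one_dyadicTable`); the range `b ∈ [1.7, 2)` is new.

HONEST FRAMING: a statement about MODEL lattice ODEs (route SubOnsagerCeiling, rung TL-M2Break,
one-mode chain class at large scale ratio); nothing here bears on Navier–Stokes regularity and no
crux, rung target or summit is proved (the rung target asks this for ALL tables of `E₂(R)`).
[cite: BarbatoMorandinRomito2011, Thm. 1, §2 Lemma 2.1] [cite: Tao2016AveragedNS, §4 (4.5), (4.13), Thm. 4.2]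
-/

noncomputable section

-- the sub-problem namespace `NavierStokesRegularity.NavierStokesRegularity` is the tree's layout (D-0017)
set_option linter.dupNamespace false

namespace Summit.NavierStokesRegularity.NavierStokesRegularity.Theorems

open Set Filter
open scoped Topology
open Literature.Analysis.FluidPDE.TaoCascade

/-! ## The scaled dyadic tables are in `E₂(2/c)` -/

/-- For `0 < c ≤ 1` the scaled dyadic table `c · dyadicTable` is symmetric, cancelling and
`(2/c)`-comparable. [cite: Tao2016AveragedNS, §4 (4.2)–(4.3); cell vocabulary] -/
theorem inTableClass_scaledDyadic {c : ℝ} (hc0 : 0 < c) (hc1 : c ≤ 1) :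
    InTableClass (2 / c) (fun i₁ i₂ i₃ μ => c * dyadicTable i₁ i₂ i₃ μ) := by
  obtain ⟨hs, hca, hco⟩ := inTableClass_dyadicTable (le_refl (2 : ℝ))
  refine ⟨fun i₁ i₂ i₃ μ₁ μ₂ μ₃ hμ => ?_, fun i₁ i₂ i₃ μ₁ μ₂ μ₃ hμ => ?_, fun i₁ i₂ i₃ μ hμ => ?_⟩
  · show c * dyadicTable i₁ i₂ i₃ (μ₁, μ₂, μ₃) = c * dyadicTable i₂ i₁ i₃ (μ₂, μ₁, μ₃)
    rw [hs i₁ i₂ i₃ μ₁ μ₂ μ₃ hμ]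
  · have h := hca i₁ i₂ i₃ μ₁ μ₂ μ₃ hμ
    show c * dyadicTable i₁ i₂ i₃ (μ₁, μ₂, μ₃) + c * dyadicTable i₁ i₃ i₂ (μ₁, μ₃, μ₂) +
          c * dyadicTable i₂ i₁ i₃ (μ₂, μ₁, μ₃) + c * dyadicTable i₂ i₃ i₁ (μ₂, μ₃, μ₁) +
          c * dyadicTable i₃ i₁ i₂ (μ₃, μ₁, μ₂) + c * dyadicTable i₃ i₂ i₁ (μ₃, μ₂, μ₁) = 0
    calc c * dyadicTable i₁ i₂ i₃ (μ₁, μ₂, μ₃) + c * dyadicTable i₁ i₃ i₂ (μ₁, μ₃, μ₂) +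
          c * dyadicTable i₂ i₁ i₃ (μ₂, μ₁, μ₃) + c * dyadicTable i₂ i₃ i₁ (μ₂, μ₃, μ₁) +
          c * dyadicTable i₃ i₁ i₂ (μ₃, μ₁, μ₂) + c * dyadicTable i₃ i₂ i₁ (μ₃, μ₂, μ₁)
        = c * (dyadicTable i₁ i₂ i₃ (μ₁, μ₂, μ₃) + dyadicTable i₁ i₃ i₂ (μ₁, μ₃, μ₂) +
          dyadicTable i₂ i₁ i₃ (μ₂, μ₁, μ₃) + dyadicTable i₂ i₃ i₁ (μ₂, μ₃, μ₁) +
          dyadicTable i₃ i₁ i₂ (μ₃, μ₁, μ₂) + dyadicTable i₃ i₂ i₁ (μ₃, μ₂, μ₁)) := by ring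
      _ = 0 := by rw [h, mul_zero]
  · obtain ⟨h1, h2⟩ := hco i₁ i₂ i₃ μ hμ
    show |c * dyadicTable i₁ i₂ i₃ μ| ≤ 1 ∧
      (c * dyadicTable i₁ i₂ i₃ μ = 0 ∨ (2 / c)⁻¹ ≤ |c * dyadicTable i₁ i₂ i₃ μ|)
    refine ⟨?_, ?_⟩
    · rw [abs_mul, abs_of_pos hc0]
      calc c * |dyadicTable i₁ i₂ i₃ μ| ≤ 1 * 1 :=
            mul_le_mul hc1 h1 (abs_nonneg _) zero_le_one
        _ = 1 := one_mul 1
    · rcases h2 with h0 | hge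
      · left; rw [h0, mul_zero]
      · right
        rw [abs_mul, abs_of_pos hc0, show (2 / c)⁻¹ = c * 2⁻¹ by rw [inv_div]; ring]
        exact mul_le_mul_of_nonneg_left hge hc0.le

/-! ## Non-negativity above the datum shell (Cheskidov positivity for the chain) -/

/-- Along every regular solution of the viscous lattice with table `c · dyadicTable` (`c ≥ 0`) from a
one-shell datum at shell `0`, every mode on a shell `k ≥ 1` is `≥ 0` on `[0, s]`: on component `0`
by variation of constants (`Ẋ_k = cΛ_{k-1}X²_{k-1} − (cΛ_kX_{k+1} + ν_k)X_k`, `X_k(0) = 0`), off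
component `0` because those modes solve `Ẋ = −ν_kX` from `0`.
[cite: BarbatoMorandinRomito2011, §2 (positivity)] [cite: Tao2016AveragedNS, §4 (4.13)] -/
theorem scaledDyadic_nonneg {c ε₀ ν s : ℝ} (hc : 0 ≤ c) (hε : 0 < ε₀)
    {α : Fin 4 → Fin 4 → Fin 4 → ℤ × ℤ × ℤ → ℝ}
    (hα : ∀ (i₁ i₂ i₃ : Fin 4) (μ : ℤ × ℤ × ℤ), α i₁ i₂ i₃ μ = c * dyadicTable i₁ i₂ i₃ μ)
    {X₀ : Fin 4 → ℝ} {X : Fin 4 → ℤ → ℝ → ℝ}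
    (hinit : ∀ (i : Fin 4) (k : ℤ), X i k 0 = if k = 0 then X₀ i else 0)
    (hcont : ∀ (i : Fin 4) (k : ℤ), Continuous (X i k))
    (hode : ∀ (i : Fin 4) (k : ℤ), ∀ t ∈ Icc (0 : ℝ) s, HasDerivWithinAt (X i k)
      (quadTerm ε₀ α X i k t - ν * (1 + ε₀) ^ ((2 : ℝ) * k) * X i k t) (Icc (0 : ℝ) s) t) :
    ∀ t ∈ Icc (0 : ℝ) s, ∀ (i : Fin 4) (k : ℤ), 1 ≤ k → 0 ≤ X i k t := by
  intro t ht i k hk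
  have hb : 0 < 1 + ε₀ := by linarith
  have hk0 : X i k 0 = 0 := by rw [hinit, if_neg (by omega)]
  -- the mode solves `ġ = A + β g` with `A ≥ 0` continuous, `β` continuous
  set A : ℝ → ℝ := fun r =>
    if i = 0 then c * (1 + ε₀) ^ ((5 : ℝ) * (k - 1) / 2) * X 0 (k - 1) r ^ 2 else 0 with hA
  set β : ℝ → ℝ := fun r =>
    -(if i = 0 then c * (1 + ε₀) ^ ((5 : ℝ) * k / 2) * X 0 (k + 1) r else 0) -
      ν * (1 + ε₀) ^ ((2 : ℝ) * k) with hβ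
  have hAc : ContinuousOn A (Icc 0 s) := by
    by_cases hi : i = 0
    · simp only [hA, hi, if_true]
      exact (continuous_const.mul ((hcont 0 (k - 1)).pow 2)).continuousOn
    · simp only [hA, hi, if_false]; exact continuousOn_const
  have hβc : ContinuousOn β (Icc 0 s) := by
    by_cases hi : i = 0
    · simp only [hβ, hi, if_true]
      exact ((continuous_const.mul (hcont 0 (k + 1))).neg.sub continuous_const).continuousOn
    · simp only [hβ, hi, if_false, neg_zero, zero_sub]; exact continuousOn_const
  have hA0 : ∀ r, 0 ≤ A r := by
    intro r; simp only [hA]; split_ifs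
    · exact mul_nonneg (mul_nonneg hc (Real.rpow_nonneg hb.le _)) (sq_nonneg _)
    · exact le_rfl
  have hg' : ∀ r ∈ Ico (0 : ℝ) s, HasDerivWithinAt (X i k) (A r + β r * X i k r) (Ici r) r := by
    intro r hr
    have h := (hode i k r (Ico_subset_Icc_self hr)).mono_of_mem_nhdsWithin (Icc_mem_nhdsGE_of_mem hr)
    refine h.congr_deriv ?_
    by_cases hi : i = 0
    · subst hi
      rw [dyadicRatioTwo_quadTerm_const_mul hα, quadTerm_dyadicTable_zero]
      simp only [hA, hβ, if_true]
      ring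
    · rw [dyadicRatioTwo_quadTerm_of_ne hα X hi]
      simp only [hA, hβ, hi, if_false]
      ring
  have key := Literature.Analysis.ODE.linearComparison_le (hcont i k).continuousOn hg' hAc hβc
    (fun r _ => le_rfl) ht
  rw [hk0, zero_add] at key
  refine le_trans (mul_nonneg (Real.exp_pos _).le ?_) key
  exact intervalIntegral.integral_nonneg ht.1 fun r _ => mul_nonneg (hA0 r) (Real.exp_pos _).le

/-! ## The subcritical envelope and global regular solutions -/

/-- **Global regular solutions at every scale ratio `1+ε₀ ∈ [17/10, 2]` for the scaled dyadic
tables**: for `ε₀ ∈ [7/10, 1]`, `0 < c ≤ 1`, every `ν > 0` and every one-shell datum, the viscous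
lattice with table `c · dyadicTable` has a global regular solution (`ViscousGlobal`).
[cite: BarbatoMorandinRomito2011, Thm. 1] [cite: Tao2016AveragedNS, §4 (4.13)] -/
theorem dyadicRange_viscousGlobal {ε₀ c ν : ℝ} (hε : 7 / 10 ≤ ε₀) (hε1 : ε₀ ≤ 1) (hc0 : 0 < c)
    (hc1 : c ≤ 1) (hν : 0 < ν) (X₀ : Fin 4 → ℝ) :
    ∃ X : Fin 4 → ℤ → ℝ → ℝ,
      ViscousGlobal ε₀ ν (fun i₁ i₂ i₃ μ => c * dyadicTable i₁ i₂ i₃ μ) X₀ X := by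
  have hε0 : 0 < ε₀ := by linarith
  have hb1 : (1 : ℝ) < 1 + ε₀ := by linarith
  have hb0 : (0 : ℝ) ≤ 1 + ε₀ := by linarith
  set α : Fin 4 → Fin 4 → Fin 4 → ℤ × ℤ × ℤ → ℝ := fun i₁ i₂ i₃ μ => c * dyadicTable i₁ i₂ i₃ μ
    with hαdef
  have hα : ∀ (i₁ i₂ i₃ : Fin 4) (μ : ℤ × ℤ × ℤ), α i₁ i₂ i₃ μ = c * dyadicTable i₁ i₂ i₃ μ :=
    fun _ _ _ _ => rfl
  have hT : InTableClass (2 / c) α := inTableClass_scaledDyadic hc0 hc1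
  -- the envelope exponent `η = 2θ - 1 = 1/100` and the geometric ratio
  set θ : ℝ := 101 / 200 with hθ
  set r : ℝ := (1 + ε₀) ^ (-(2 * θ)) with hr_def
  have hr0 : 0 < r := Real.rpow_pos_of_pos (by linarith) _
  have hr1 : r < 1 := by
    have : (1 + ε₀) ^ (-(2 * θ)) < (1 + ε₀) ^ (0 : ℝ) :=
      Real.rpow_lt_rpow_of_exponent_lt hb1 (by rw [hθ]; norm_num)
    simpa [hr_def] using this
  have h1r : 0 < 1 - r := by linarith
  set E₀ : ℝ := ∑ j : Fin 4, (1 / 2 : ℝ) * X₀ j ^ 2 with hE₀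
  have hE₀0 : 0 ≤ E₀ := Finset.sum_nonneg fun j _ => by positivity
  refine exists_viscousGlobal_of_subcriticalEnvelope_of_inTableClass (η := 2 * θ - 1) hε0.le
    (by rw [hθ]; norm_num) hν hT X₀ (fun T _hT => ⟨400 * E₀ / (1 - r), ?_⟩)
  intro s hs X hinit hlow hbd hcont hder n N hnN t ht
  have hnn := scaledDyadic_nonneg hc0.le hε0 hα hinit hcont hder
  have H := dyadicRange_shellBarrier hc0 hε hε1 hα ν hν X₀ s hs.1 X hinit hlow hbd hcont hder hnn t ht
  -- per shell: `Σ_i ½X² ≤ 400 E₀ r^k`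
  have hpow : ∀ k : ℕ, (1 + ε₀) ^ (2 * θ * (k : ℝ)) * r ^ k = 1 := by
    intro k
    rw [hr_def, ← Real.rpow_mul_natCast hb0, ← Real.rpow_add (by linarith)]
    have : 2 * θ * (k : ℝ) + -(2 * θ) * (k : ℝ) = 0 := by ring
    rw [this, Real.rpow_zero]
  have hshell : ∀ k : ℕ, ∑ i : Fin 4, (1 / 2 : ℝ) * X i (k : ℤ) t ^ 2 ≤ 400 * E₀ * r ^ k := by
    intro k
    have hk : ∀ i : Fin 4, (1 / 2 : ℝ) * X i (k : ℤ) t ^ 2 ≤ 100 * E₀ * r ^ k := by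
      intro i
      have Hi := H i k
      rw [show (2 : ℝ) * (101 / 200) * (k : ℝ) = 2 * θ * (k : ℝ) by rw [hθ]] at Hi
      have hrk : 0 < r ^ k := pow_pos hr0 k
      have := mul_le_mul_of_nonneg_right Hi hrk.le
      calc (1 / 2 : ℝ) * X i (k : ℤ) t ^ 2
          = ((1 + ε₀) ^ (2 * θ * (k : ℝ)) * r ^ k) * ((1 / 2 : ℝ) * X i (k : ℤ) t ^ 2) := by
            rw [hpow k, one_mul]
        _ = (1 + ε₀) ^ (2 * θ * (k : ℝ)) * ((1 / 2 : ℝ) * X i (k : ℤ) t ^ 2) * r ^ k := by ring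
        _ ≤ 100 * (∑ j : Fin 4, (1 / 2 : ℝ) * X₀ j ^ 2) * r ^ k := this
        _ = 100 * E₀ * r ^ k := by rw [hE₀]
    calc ∑ i : Fin 4, (1 / 2 : ℝ) * X i (k : ℤ) t ^ 2
        ≤ ∑ _i : Fin 4, 100 * E₀ * r ^ k := Finset.sum_le_sum fun i _ => hk i
      _ = 400 * E₀ * r ^ k := by simp [Finset.sum_const, Finset.card_univ, Fintype.card_fin]; ring
  have hgeom : ∑ k ∈ Finset.Icc n N, r ^ k ≤ r ^ n / (1 - r) := by
    rw [← Finset.Ico_add_one_right_eq_Icc]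
    exact geom_sum_Ico_le_of_lt_one hr0.le hr1
  have hrn : r ^ n = (1 + ε₀) ^ (-((1 + (2 * θ - 1)) * (n : ℝ))) := by
    rw [hr_def, ← Real.rpow_mul_natCast hb0]
    congr 1; ring
  calc ∑ k ∈ Finset.Icc n N, ∑ i : Fin 4, (1 / 2 : ℝ) * X i (k : ℤ) t ^ 2
      ≤ ∑ k ∈ Finset.Icc n N, 400 * E₀ * r ^ k := Finset.sum_le_sum fun k _ => hshell k
    _ = 400 * E₀ * ∑ k ∈ Finset.Icc n N, r ^ k := by rw [Finset.mul_sum (s := Finset.Icc n N)]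
    _ ≤ 400 * E₀ * (r ^ n / (1 - r)) := mul_le_mul_of_nonneg_left hgeom (by positivity)
    _ = 400 * E₀ / (1 - r) * (1 + ε₀) ^ (-((1 + (2 * θ - 1)) * (n : ℝ))) := by
        rw [← hrn]; field_simp

/-- **No Theorem-4.2-level blow-up on the one-mode chain class at every scale ratio
`1+ε₀ ∈ [17/10, 2]`**: for `ε₀ ∈ [7/10, 1]`, `0 < c ≤ 1` and every one-shell datum,
`¬ NoGlobalCascade ε₀ (c · dyadicTable) X₀` (a global regular viscous solution at viscosity `κ/√2`
is a global `(κ, κ)`-pseudo-solution). [cite: Tao2016AveragedNS, §4 Thm. 4.2 (statement shape)] -/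
theorem dyadicRange_not_noGlobalCascade {ε₀ c : ℝ} (hε : 7 / 10 ≤ ε₀) (hε1 : ε₀ ≤ 1) (hc0 : 0 < c)
    (hc1 : c ≤ 1) (X₀ : Fin 4 → ℝ) :
    ¬ NoGlobalCascade ε₀ (fun i₁ i₂ i₃ μ => c * dyadicTable i₁ i₂ i₃ μ) X₀ := by
  intro hNG
  have hε0 : 0 < ε₀ := by linarith
  obtain ⟨κ, hκ, hno⟩ := (noGlobalCascade_iff_kappa hε0).1 hNG
  have h2 : 0 < Real.sqrt 2 := Real.sqrt_pos.2 two_pos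
  have hν : 0 < κ / Real.sqrt 2 := div_pos hκ h2
  obtain ⟨X, hX⟩ := dyadicRange_viscousGlobal hε hε1 hc0 hc1 hν X₀
  have hG := hasGlobal_of_viscousGlobal hε0 hν.le hX
  rw [div_mul_cancel₀ κ h2.ne'] at hG
  exact hno (hasGlobal_mono hε0.le hG le_rfl hκ.le)

end Summit.NavierStokesRegularity.NavierStokesRegularity.Theorems

end
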